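import Mathlib.LinearAlgebra.Charpoly.Basic
import Mathlib.LinearAlgebra.Matrix.Charpoly.Coeff
import Mathlib.Algebra.Polynomial.Reverse
import Mathlib.LinearAlgebra.Trace
import Literature.AlgebraicGeometry.Motives.ZetaFunction
import Literature.AlgebraicGeometry.Motives.GaloisRealization
import HarnessLib

-- provenance: harness21/H21/H21/Prelude/MotiveL/FrobeniusTrace.lean @ e9807c0 (interim HEAD d8f2665); M5 mechanical rewrite
/-!
# Frobenius traces and the cohomological side of the zeta function (trunk MotiveL, prelude C4)

Let `k` be a finite field with `q` elements, `K` a field of characteristic zero and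
`E : Literature.GaloisWeilCohomology k K χ` a Weil cohomology theory on smooth projective `k`-varieties
with a `K`-linear action `E.ρ X i` of `Γ_k = Gal(k̄/k)` on each `Hⁱ(X)` (accepted G17
`GaloisRealization`; the intended value is `ℓ`-adic étale cohomology `Hⁱ_ét(X_{k̄}, ℚ_ℓ)`).
The *geometric* Frobenius `F = geomFrob k ∈ Γ_k` (accepted C3 `ZetaFunction`) then acts on
`Hⁱ(X)` and we define

* `E.frobAction X i : Hⁱ(X) →ₗ[K] Hⁱ(X)`, the endomorphism `F | Hⁱ(X)`;
* `E.frobCharPoly X i = det(1 - T·F | Hⁱ(X)) ∈ K[T]`, the reversed characteristic polynomial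
  (Mathlib `LinearMap.charpoly`, `Polynomial.reverse`; cf. `Matrix.reverse_charpoly`);
* `E.frobTracePow X i m = tr(Fᵐ | Hⁱ(X))` (Mathlib `LinearMap.trace`);
* the **Lefschetz trace formula** as a property of `E`, `E.HasLefschetzTraceFormula`:
  `#X(𝔽_{q^m}) = ∑ᵢ (-1)ⁱ tr(Fᵐ | Hⁱ(X))` for `X` smooth projective and `m ≥ 1`;
* integrality and the Riemann hypothesis for the `Pᵢ(T) = det(1 - T·F | Hⁱ(X))`:
  `E.IsIntegralModel X i P`, `E.WeilRiemannHypothesisFor X n`;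
* the formal consequence `Z(X, T) · ∏_{i even} Pᵢ(T) = ∏_{i odd} Pᵢ(T)`
  (`zetaSeries_mul_prod_frobCharPoly`) of the trace formula and the identity
  `exp (∑_{m ≥ 1} tr(Fᵐ) Tᵐ / m) = det(1 - T·F)⁻¹`.

## Sources

* A. Grothendieck, *Formule de Lefschetz et rationalité des fonctions L*, Sém. Bourbaki 279
  (1964/65).
* P. Deligne, *La conjecture de Weil. I*, Publ. Math. IHÉS 43 (1974), (1.5)–(1.6), esp. (1.5.4).
* N. Katz, W. Messing, *Some consequences of the Riemann hypothesis for varieties over finite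
  fields*, Invent. Math. 23 (1974) (integrality and independence of `ℓ` of the `Pᵢ`).

## Design notes

* Mathlib searches: `LinearMap.charpoly` (`Mathlib/LinearAlgebra/Charpoly/Basic.lean`, needs
  `Module.Free`/`Module.Finite`; freeness is automatic over the field `K`),
  `Matrix.reverse_charpoly` (`det(1 - T·M)` is the reverse of `charpoly M`),
  `Polynomial.coeff_zero_reverse`, `Polynomial.reverse_natDegree_le`,
  `LinearMap.charpoly_natDegree`, `LinearMap.trace` are all used. Mathlib has no Lefschetz
  trace formula, no zeta function of a variety and no Frobenius action on cohomology
  (searched `Lefschetz`, `frob.*charpoly`, `trace formula`).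
* **Junk value.** `LinearMap.charpoly` needs `Module.Finite K (Hⁱ(X))`, which `E` only
  guarantees for smooth projective `X` (`E.finite_obj hX i`). `frobCharPoly` is therefore a
  `dite` on `Module.Finite K (E.obj X i)` with junk value `1` otherwise, exactly the shape of the
  accepted G09 `ArtinRep.eulerFactorAt`/`ArtinRep.eulerPolynomial`; `frobCharPoly_eq` kills the
  junk branch under `IsSmoothProjective n X`, and `coeff_zero_frobCharPoly`,
  `natDegree_frobCharPoly_le` hold in both branches. `frobTracePow` needs no finiteness
  (`LinearMap.trace` is `0` on non-finite modules, Mathlib's own junk value).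
* **Frobenius convention (OUTLINE §1(d)).** Everything here uses the *geometric* Frobenius
  `geomFrob k = (arithFrob k)⁻¹`, as in Deligne (1.5): the trace formula and the local factors
  `det(1 - T·F | Hⁱ)` are stated for `F = geomFrob k`. The accepted G09 declaration
  `GaloisRep.frobCharpoly` (trunk GalRep) is the characteristic polynomial of an *arithmetic*
  Frobenius at a finite place of a number field; **no identification between the two is made
  or claimed here** (they differ by `F ↦ F⁻¹`, i.e. by the functional equation / duality).
* `IsIntegralModel` uses `Int.castRingHom K` (as C3's `IsWeilFactorization` uses
  `Int.castRingHom ℚ`); this is `algebraMap ℤ K` by `algebraMap_int_eq`.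
* Declarations live in `namespace Literature.GaloisWeilCohomology` so that dot notation `E.frobAction`
  etc. is available, matching G17's `E.ρTwist`, `E.tateClasses`.
* **`HasLefschetzTraceFormula` is a hypothesis on `E`, not a named fact.** It is a predicate with
  the explicit binder `(E : GaloisWeilCohomology k K χ)`, consumed as `(hE : E.HasLefschetzTraceFormula)`
  (`zetaSeries_mul_prod_frobCharPoly`, `Literature/NumberTheory/LFunctions/WeilConjectures*Proofs`);
  the published theorem it abstracts (Grothendieck's trace formula for `ℓ`-adic cohomology) is the
  closed existence fact `exists_galoisWeilCohomology_hasLefschetzTraceFormula` of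
  `EllAdicWeilCohomology`. Its universal closure over all `E` is refutable from any Weil cohomology
  theory: `not_forall_hasLefschetzTraceFormula` (the axioms of `GaloisWeilCohomology` do not tie
  `ρ (geomFrob k)` to the Frobenius morphism; Deligne (1.15), Milne VI Rem. 13.5).
-/

universe u v

open CategoryTheory AlgebraicGeometry Polynomial

noncomputable section

namespace Literature.AlgebraicGeometry.Motives

namespace GaloisWeilCohomology

variable {k : Type u} [Field k] [Finite k] {K : Type v} [Field K] [CharZero K]
  {χ : Field.absoluteGaloisGroup k →* Kˣ} (E : GaloisWeilCohomology k K χ)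

/-! ### The Frobenius endomorphism of cohomology -/

section Frobenius

/-- The action of the **geometric Frobenius** `F = φ⁻¹ ∈ Gal(k̄/k)` on `Hⁱ(X)`, as a `K`-linear
endomorphism: `E.ρ X i (geomFrob k)` (Deligne, *Weil I* (1974), (1.5); Grothendieck, Sém.
Bourbaki 279 (1964/65)). [folklore] -/
def frobAction (X : SchemeOver k) (i : ℕ) : E.obj X i →ₗ[K] E.obj X i :=
  E.ρ X i (geomFrob k)

/-- `E.frobAction X i = E.ρ X i (geomFrob k)` (by definition). [folklore] -/
theorem frobAction_def (X : SchemeOver k) (i : ℕ) : E.frobAction X i = E.ρ X i (geomFrob k) :=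
  rfl

/-- Powers of the Frobenius endomorphism are the action of powers of the geometric Frobenius:
`Fᵐ | Hⁱ(X) = ρ(Fᵐ)` (`ρ` is a monoid homomorphism; Deligne, *Weil I* (1974), (1.5)). [folklore] -/
theorem frobAction_pow (X : SchemeOver k) (i : ℕ) (m : ℕ) :
    E.frobAction X i ^ m = E.ρ X i (geomFrob k ^ m) := by
  rw [frobAction, map_pow]

open scoped Classical in
/-- The polynomial `Pᵢ(X, T) = det(1 - T·F | Hⁱ(X)) ∈ K[T]`, `F` the geometric Frobenius
(Deligne, *Weil I* (1974), (1.5.4); Grothendieck, Sém. Bourbaki 279 (1964/65)): the reverse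
(`Polynomial.reverse`, cf. Mathlib `Matrix.reverse_charpoly`) of the characteristic polynomial
of `E.frobAction X i`. **Junk value `1`** when `Hⁱ(X)` is not finite dimensional over `K`
(`LinearMap.charpoly` is then undefined); for smooth projective `X` this branch never occurs
(`E.finite_obj`, see `frobCharPoly_eq`). Same shape as `ArtinRep.eulerFactorAt` (G09). [folklore] -/
def frobCharPoly (X : SchemeOver k) (i : ℕ) : K[X] :=
  if h : Module.Finite K (E.obj X i) then (haveI := h; (E.frobAction X i).charpoly.reverse)
  else 1

/-- Unfolding `frobCharPoly` on a finite-dimensional `Hⁱ(X)`: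
`Pᵢ(X, T) = reverse (charpoly (F | Hⁱ(X)))` (Deligne, *Weil I* (1974), (1.5.4)). [folklore] -/
theorem frobCharPoly_of_finite (X : SchemeOver k) (i : ℕ) [h : Module.Finite K (E.obj X i)] :
    E.frobCharPoly X i = (E.frobAction X i).charpoly.reverse := by
  rw [frobCharPoly, dif_pos h]

/-- For `X` smooth projective, `Pᵢ(X, T) = reverse (charpoly (F | Hⁱ(X)))` with the finiteness
instance `E.finite_obj hX i`; the junk branch of `frobCharPoly` does not occur
(Deligne, *Weil I* (1974), (1.5.4)). [folklore] -/
theorem frobCharPoly_eq {n : ℕ} {X : SchemeOver k} (hX : IsSmoothProjective n X) (i : ℕ) :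
    E.frobCharPoly X i =
      (haveI := E.finite_obj hX i; (E.frobAction X i).charpoly.reverse) := by
  haveI := E.finite_obj hX i
  exact E.frobCharPoly_of_finite X i

/-- `Pᵢ(X, 0) = 1`: the constant coefficient of `det(1 - T·F | Hⁱ(X))` is `1` (in both branches
of the definition: `Polynomial.coeff_zero_reverse` and monicity of the characteristic
polynomial; Deligne, *Weil I* (1974), (1.5.4)). [folklore] -/
@[simp]
theorem coeff_zero_frobCharPoly (X : SchemeOver k) (i : ℕ) : (E.frobCharPoly X i).coeff 0 = 1 := by
  unfold frobCharPoly
  split_ifs with h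
  · rw [Polynomial.coeff_zero_reverse, (LinearMap.charpoly_monic _).leadingCoeff]
  · simp

/-- `deg Pᵢ(X, T) ≤ dim_K Hⁱ(X) = bᵢ(X)` (with equality iff `F` is invertible on `Hⁱ(X)`, which
holds since `ρ` is a group representation, but only the inequality is recorded here). True in
both branches of the definition (`Polynomial.reverse_natDegree_le`,
`LinearMap.charpoly_natDegree`; Deligne, *Weil I* (1974), (1.5.4)). [folklore] -/
theorem natDegree_frobCharPoly_le (X : SchemeOver k) (i : ℕ) :
    (E.frobCharPoly X i).natDegree ≤ Module.finrank K (E.obj X i) := by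
  unfold frobCharPoly
  split_ifs with h
  · exact (Polynomial.reverse_natDegree_le _).trans (LinearMap.charpoly_natDegree _).le
  · simp

/-- The trace `tr(Fᵐ | Hⁱ(X)) ∈ K` of the `m`-th power of the geometric Frobenius on `Hⁱ(X)`
(Mathlib `LinearMap.trace`, which is `0` on modules that are not finite free — its own junk
value; Grothendieck, Sém. Bourbaki 279 (1964/65); Deligne, *Weil I* (1974), (1.5.1)). [folklore] -/
def frobTracePow (X : SchemeOver k) (i : ℕ) (m : ℕ) : K :=
  LinearMap.trace K (E.obj X i) (E.frobAction X i ^ m)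

/-- `tr(Fᵐ | Hⁱ(X)) = tr(ρ(Fᵐ) | Hⁱ(X))` (Deligne, *Weil I* (1974), (1.5.1)). [folklore] -/
theorem frobTracePow_eq_trace_ρ (X : SchemeOver k) (i : ℕ) (m : ℕ) :
    E.frobTracePow X i m = LinearMap.trace K (E.obj X i) (E.ρ X i (geomFrob k ^ m)) := by
  rw [frobTracePow, frobAction_pow]

end Frobenius

/-! ### The Lefschetz trace formula and the Riemann hypothesis, as properties of `E` -/

section TraceFormula

/-- The **Grothendieck–Lefschetz trace formula** as a *hypothesis* on the Galois Weil cohomology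
theory `E` over the finite field `k` (a `Prop`-valued predicate on `E`, like
`WeilCohomology.HasHardLefschetz`; users take `(hE : E.HasLefschetzTraceFormula)`): for every
smooth projective `X` of dimension `n` and every `m ≥ 1`,
`#X(𝔽_{q^m}) = ∑_{i=0}^{2n} (-1)ⁱ tr(Fᵐ | Hⁱ(X))` in `K`, where `F = E.frobAction X i` is the action
of the geometric Frobenius *element* `geomFrob k ∈ Gal(k̄/k)` through `E.ρ`.

This abstracts Grothendieck's theorem for `ℓ`-adic étale cohomology, `ℓ ≠ char k`
(Grothendieck, Sém. Bourbaki 279 (1964/65); Deligne, *La conjecture de Weil. I* (1974), (1.5.1),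
p. 275: `#X₀(𝔽_{qⁿ}) = ∑ᵢ (-1)ⁱ Tr(F*ⁿ, Hⁱ_c(X, ℚ_ℓ))` for the Frobenius *morphism* `F : X → X`,
identified with the geometric Frobenius element of `Gal(𝔽̄_q/𝔽_q)` in (1.15), p. 279; Milne,
*Étale cohomology*, VI Thm. 13.4 and Rem. 13.5), which this tree records as the closed existence
fact `Literature.AlgebraicGeometry.Motives.exists_galoisWeilCohomology_hasLefschetzTraceFormula`
(`EllAdicWeilCohomology`). It is **not** a consequence of the axioms of `GaloisWeilCohomology`,
which do not tie `ρ (geomFrob k)` to the Frobenius morphism: see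
`not_forall_hasLefschetzTraceFormula` below. The structure argument `E` is an explicit binder
(a parametrised predicate, not a closed named fact; the elaborated declaration is unchanged).
[cite: Deligne1974, (1.5.1) p. 275 and (1.15) p. 279] -/
def HasLefschetzTraceFormula (E : GaloisWeilCohomology k K χ) : Prop :=
  ∀ ⦃n : ℕ⦄ ⦃X : SchemeOver k⦄, IsSmoothProjective n X → ∀ m : ℕ, 0 < m →
    (pointCount X m : K) =
      ∑ i ∈ Finset.range (2 * n + 1), (-1 : K) ^ i * E.frobTracePow X i m

/-- **The trace formula is a genuine hypothesis on `E`: it does not follow from the axioms of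
`GaloisWeilCohomology`.** Given any Weil cohomology theory `W` over the finite field `k` and a
smooth projective `X` with `#X(𝔽_q) ≠ #X(𝔽_{q²})` (e.g. `X = ℙ¹`, `q + 1 ≠ q² + 1`), the Galois Weil
cohomology theory `(W, ρ := 1)` for the trivial character `χ = 1` satisfies all of Tate's
compatibilities (`pullback_ρ`, `cup_ρ`, `trace_ρ`, `cycleClass_ρ` hold trivially) but violates the
trace formula, because `tr(Fᵐ | Hⁱ(X)) = tr(1 | Hⁱ(X))` does not depend on `m`. What the axioms do
not contain is the identification of `ρ (geomFrob k)` with the pull-back `F*` by the Frobenius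
morphism, which holds for étale cohomology (Deligne, *Weil I* (1974), (1.15), p. 279; Milne,
*Étale cohomology*, VI Rem. 13.5). In particular the universal closure
`∀ χ E, E.HasLefschetzTraceFormula` is refutable from the existence of one Weil cohomology theory
over `k` together with the point count of `ℙ¹`. [folklore] -/
theorem not_forall_hasLefschetzTraceFormula (W : WeilCohomology k K) {n : ℕ} {X : SchemeOver k}
    (hX : IsSmoothProjective n X) (hN : pointCount X 1 ≠ pointCount X 2) :
    ¬ ∀ (χ' : Field.absoluteGaloisGroup k →* Kˣ) (E' : GaloisWeilCohomology k K χ'),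
        E'.HasLefschetzTraceFormula := by
  intro H
  -- the trivial Galois structure `ρ = 1`, `χ = 1` on `W`
  let E₁ : GaloisWeilCohomology k K 1 :=
    { toWeilCohomology := W
      ρ := fun Y i => Representation.trivial K _ _
      pullback_ρ := by intros; simp
      cup_ρ := by intros; simp
      trace_ρ := by intros; simp
      cycleClass_ρ := by intros; simp }
  have htr : ∀ i m, E₁.frobTracePow X i m = LinearMap.trace K (W.obj X i) 1 := fun i m => by
    rw [frobTracePow, frobAction]
    change LinearMap.trace K _ ((Representation.trivial K _ _ (geomFrob k)) ^ m) = _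
    rw [Representation.isTrivial_def, ← Module.End.one_eq_id, one_pow]
  have h1 := H 1 E₁ hX 1 one_pos
  have h2 := H 1 E₁ hX 2 two_pos
  simp only [htr] at h1 h2
  exact hN (by exact_mod_cast h1.trans h2.symm)

/-- `P ∈ ℤ[T]` is an **integral model** of `Pᵢ(X, T) = det(1 - T·F | Hⁱ(X)) ∈ K[T]`: the image
of `P` under `ℤ[T] → K[T]` is `E.frobCharPoly X i`. For `ℓ`-adic cohomology of a smooth
projective `X` such a `P` exists and is independent of `ℓ` (Deligne, *Weil I* (1974),
Thm. (1.6); Katz–Messing (1974), Thm. 1). Since `char K = 0`, `P` is unique if it exists. [cite: KatzMessing1974] -/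
def IsIntegralModel (X : SchemeOver k) (i : ℕ) (P : ℤ[X]) : Prop :=
  P.map (Int.castRingHom K) = E.frobCharPoly X i

/-- The **Riemann hypothesis part of the Weil conjectures** for `E` and `X` of dimension `n`
(Deligne, *Weil I* (1974), Thm. (1.6)): for every `0 ≤ i ≤ 2n` the polynomial
`Pᵢ(X, T) = det(1 - T·F | Hⁱ(X))` has an integral model `Pᵢ ∈ ℤ[T]` all of whose complex roots
`z` satisfy `|z| = q^{-i/2}` (i.e. `Pᵢ(T) = ∏ⱼ (1 - α_{ij} T)` with `|α_{ij}| = q^{i/2}` for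
every complex embedding), `q = Nat.card k`. The root condition is literally that of C3's
`IsWeilFactorization`. [folklore] -/
def WeilRiemannHypothesisFor (X : SchemeOver k) (n : ℕ) : Prop :=
  ∃ P : Fin (2 * n + 1) → ℤ[X],
    (∀ i : Fin (2 * n + 1), E.IsIntegralModel X i (P i)) ∧
    ∀ (i : Fin (2 * n + 1)) (z : ℂ), ((P i).map (Int.castRingHom ℂ)).IsRoot z →
      ‖z‖ = (Nat.card k : ℝ) ^ (-((i : ℕ) : ℝ) / 2)

/-- **Cohomological expression of the zeta function** (Grothendieck, Sém. Bourbaki 279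
(1964/65), Cor. 5.2; Deligne, *Weil I* (1974), (1.5.4)): if `E` satisfies the Lefschetz trace
formula then, for `X` smooth projective of dimension `n` over `𝔽_q`,
`Z(X, T) = ∏_{i odd} Pᵢ(X, T) / ∏_{i even} Pᵢ(X, T)`, `Pᵢ(X, T) = det(1 - T·F | Hⁱ(X))`,
stated multiplied out in `K⟦T⟧`. Depends only on: `hE`, `E.finite_obj`, `E.subsingleton_obj`
(no terms beyond `i = 2n`) and the elementary identity
`exp (∑_{m ≥ 1} tr(Fᵐ) Tᵐ / m) = det(1 - T·F)⁻¹` for an endomorphism of a finite-dimensional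
vector space over a field of characteristic zero. A named fact (statement only). [cite: Grothendieck1965, Cor. 5.2] -/
def zetaSeries_mul_prod_frobCharPoly : Prop :=
  ∀ (hE : E.HasLefschetzTraceFormula) {n : ℕ} {X : SchemeOver k} (hX : IsSmoothProjective n X),
    (zetaSeries X).map (algebraMap ℚ K) *
        ∏ i ∈ (Finset.range (2 * n + 1)) with Even i, (E.frobCharPoly X i : PowerSeries K) =
      ∏ i ∈ (Finset.range (2 * n + 1)) with Odd i, (E.frobCharPoly X i : PowerSeries K)

end TraceFormula

end GaloisWeilCohomology

end Literature.AlgebraicGeometry.Motives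

end
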